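import Summits.QuantumFields.YangMills.Theorems.UnitScaleTiltFluctuationComparisonRegPrGlobalSlackCanonicalOnChiChiCV4
import HarnessLib

/-!
# `UnitScaleTiltFluctuationComparisonRegPrGlobalSlackCanonicalOnChiPolymerV4` — THE v4 TWIN (★★OWNER RULING g26-№14 (F-2b); P22b, width seat ym-ust-20520-w2 g4; skeleton v5kD; record-free decls imported from `…GlobalSlackCanonicalOnChiPolymer`) of `…GlobalSlackCanonicalOnChiPolymer` — STUB (i*)χ OF v5kC FROM ONE PER-POLYMER TWO-RUN ROW ON PRINT'S χ FOR THE CANONICAL TERM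
# FUNCTION — NO CHART FAMILY, NO LETTER ON THE RECORD (crux `FluctuationComparisonRegPrIntL`, stmt-QuantumFields-20520, skeleton v5kC STUB (i*)χ
# `stub_smallBlocksSlackOnChiAllChiV4`, odd `L ∈ {3,5}`; width seat ym-ust-20520-w2)

WHY.  Every (i*)χ socket in the tree (★r1 g2/g4: `K1aChartRowsOnChiChiV4`/`…CChi`/`…KChi`, `K1aLegRows…OnChi…`, `K1aChartRowsOnPrintChiKChiV4`) reads the stub from SIX CHART ROWS
over a free chart family `(Φ, e, B, R)` — King's kernel-matching MECHANISM ([King1986] Prop. 3.6) for the per-polymer two-run comparison.  Two of those rows read objects the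
lane's package does not display ((M1): the old terms are birth jets at the current loop variables; (M5): `Bcfg` is (27) of the composite minimiser — REPORT-K1a-display-g0 §1).
The producer ACTUALLY consumes one row stated on package-DEFINED objects only: King's per-polymer slack row ON χ for the CANONICAL term function `canonPTRows (toCore ∘ p)`
(`GlobalSlackKernelMatchingOn.PolymerCauchyMinAtWSlackOn`, whose `PT` is here a DEFINITION from the displayed fields `Ψ`, `Bcfg`, `far`, `Λc`, `oldVal` of the step records,
`…CanonicalPolymersCore`).  This file records that socket, so that a recipe proving the per-term two-run comparison by ANY method (kernel matching or not) closes (i*)χ by name: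

* §1 **`PolymerSlackOnChiKChiV4 L μ 𝔠 a₀ a₁ a`** (hypothesis schema, never asserted): a constant `C ≥ 0`, a threshold `γB > 0`, and for every family of block size `L`, admissible
  coupling and inhabited χ-record a COHERENT family `p` with the given [7]-constants such that for every regularity threshold `0 < ε₀ ≤ a₀`
  `PolymerCauchyMinAtWSlackOn (ChiGood … ε₀ μ) (dataOfV4chi p (canonPolymerRows (toCore ∘ p))) (canonPTRows (toCore ∘ p)) b₀ p₀ 𝔠.κ (θ²) a 7 C` — decay rate the record's
  `𝔠.κ`, weight `θ(n)²`, slack exponent `7`; NO chart family, NO letter;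
* §2 `slackOnChiAtChiV4_of_polymerSlackOnChiKChiV4` (one block size, one margin: the four producer rows over the core — `pintDecompTrivT_canonRows`, `locCover_canonRows` +
  `locBlockVolumeC_canonRows` (count form, no `L ≤ M₁`), `locMatched_canonRows`, `termSizeTrivT_canonRows` — and ★r1 g4's count-form On-producer
  `globalSupRateWSlackOn_of_polymerWSlackOn_count`; threshold `γB ⊓ gammaW L 𝔠 0 0 ⊓ e^{2(1−p₀)}`), **`smallBlocksSlackOnChiAllChiV4_of_polymerSlackOnChiKChiV4 : … →
  ⟨(i*)χ TEXT VERBATIM⟩**;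
* §3 `polymerSlackOnChiKChiV4_of_k1aChartRowsOnChiKChiV4`: ★r1 g4's letter-free chart rows give the polymer row (`polymerCauchyMinAtTSlackOn_of_charts`, window from `γ` small) —
  nothing proved for the chart currency is lost; the chart rows are ONE way to the polymer row.
Hypothesis schemas and bookkeeping only; nothing of [Balaban1985UV3]/[King1986] is asserted; no numerics; registry untouched (`--supports stmt-QuantumFields-20520`).  YM₃ on the
torus is a rung of the ladder, not the Clay problem; nothing here is a claim about the crux or the gap.

References: T. Bałaban, CMP 102 (1985) 255–275 [Balaban1985UV3] ((7) p.257, (24) p.262, (43)–(47) pp.266–267, (57) p.270); C. King, CMP 102 (1986) 649–677 [King1986]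
(Thm 3.4 (3.9) p.656, (3.12)–(3.13) p.657, Prop. 3.6 p.662).
-/

set_option autoImplicit false

noncomputable section

namespace Summit.QuantumFields.YangMills.Theorems.GlobalSlackCanonicalOnChi

open scoped BigOperators
open MeasureTheory Filter
open Literature.MathematicalPhysics.QuantumFieldTheory.Balaban1983to89
open Literature.MathematicalPhysics.QuantumFieldTheory.Balaban1983to89.T3ContinuumYM3Torus
open Literature.MathematicalPhysics.QuantumFieldTheory.Balaban1983to89.T3UnitScaleTilt
open Literature.MathematicalPhysics.QuantumFieldTheory.Balaban1983to89.T3AlphaInputsAC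
open Literature.MathematicalPhysics.QuantumFieldTheory.Balaban1983to89.T3AlphaPolymerSocket
open Literature.MathematicalPhysics.QuantumFieldTheory.Balaban1983to89.T3AlphaInputsACTwoRun
open Literature.MathematicalPhysics.QuantumFieldTheory.Balaban1983to89.T3AlphaInputsACTwoRunLevel
open Literature.MathematicalPhysics.QuantumFieldTheory.Balaban1983to89.T3Thresholds (θBal_succ_le)
open Literature.MathematicalPhysics.QuantumFieldTheory.Balaban1983to89.B12TreeDecay (kappa₀ K₀ K₀_pos kappa₀_nonneg)
open Literature.MathematicalPhysics.QuantumFieldTheory.Balaban1985CMP102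
open Literature.MathematicalPhysics.QuantumFieldTheory.Balaban1985CMP102.Setting
open Summit.QuantumFields.Balaban3D.Carriers
open Summit.QuantumFields.Balaban3D.Proofs.Primitives
open Summit.QuantumFields.Balaban3D.Proofs.GroupModelLieC (lieC)
open Summit.QuantumFields.YangMills.Theorems
open Summit.QuantumFields.YangMills.Theorems.GlobalSlackKernelMatching
open Summit.QuantumFields.YangMills.Theorems.GlobalSlackKernelMatchingOn
open Summit.QuantumFields.YangMills.Theorems.GlobalSlackLocalToGlobalOn
open Summit.QuantumFields.YangMills.Theorems.GlobalSlackLocalToGlobalCount (locCount_of_cover_of_volumeC)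
open Summit.QuantumFields.YangMills.Theorems.GlobalSlackCanonicalPolymers

/-! ## §1 King's per-polymer slack row on print's χ for the canonical term function of the χ-record -/

/-- **THE PER-POLYMER TWO-RUN SLACK ROW ON χ-GOOD DATA FOR THE χ-RECORD'S CANONICAL TERM FUNCTION, NO CHART FAMILY, NO LETTER** (hypothesis schema, never asserted): a constant
`C ≥ 0`, a threshold `γB > 0`, and for every family of block size `L`, coupling `γ ≤ γB` in the lane's window and inhabited χ-record a COHERENT family `p : ∀ K, PkgAtV3Chi …`
with the given [7]-constants such that for every `0 < ε₀ ≤ a₀` King's per-polymer two-cut-off row with additive slack holds ON doubly-χ-good window data for the CANONICAL term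
function `canonPTRows (toCore ∘ p)` at the datum `dataOfV4chi p (canonPolymerRows (toCore ∘ p))`: `|PT_{K+1}(refine Y) − PT_K(Y) − c_K(Y)| ≤ C·e^{−𝔠.κ·𝓛_K(Y)}·x⁴·(θ(n)²·L^{−a(1+j)}
+ θ(n)⁷)`. [cite: King1986, Thm 3.4 (3.9) p.656, Prop. 3.6 (3.56) p.662; Balaban1985UV3, (43)-(44) pp.266-267, (47) p.267, (57) p.270] -/
def PolymerSlackOnChiKChiV4 (L : ℕ) (μ : ℝ) (𝔠 : AlphaConsts L (suGroupModel 2).N) (a₀ a₁ a : ℝ) : Prop :=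
  ∃ (C γB : ℝ), 0 ≤ C ∧ 0 < γB ∧
    ∀ (F : T3Family) (γ : ℝ) (hF : F.L = L) (hγ : 0 < γ), γ ≤ γB → ∀ (hγ1 : γ ≤ (min (hF ▸ 𝔠).gamma0 1) ^ 2),
      AlphaInputsT3AC.OfV4ChiAt F (hF ▸ 𝔠) a₀ a₁ →
        ∃ (p : ∀ K, AlphaInputsT3AC.PkgAtV4Chi F (hF ▸ 𝔠) γ hγ hγ1 K), (∀ K, (p K).a₀ = a₀ ∧ (p K).a₁ = a₁) ∧
          ∀ ε₀ : ℝ, 0 < ε₀ → ε₀ ≤ a₀ →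
            PolymerCauchyMinAtWSlackOn (fun K n h V => PrintChi.ChiGood F γ (hF ▸ 𝔠).b₀ (hF ▸ 𝔠).p₀ ε₀ μ (n := n) (K := K) h V)
              (AlphaInputsT3AC.dataOfV4chi p (canonPolymerRows fun K => (p K).toRows)) (canonPTRows fun K => (p K).toRows)
              (hF ▸ 𝔠).b₀ (hF ▸ 𝔠).p₀ (hF ▸ 𝔠).κ (fun n => θBal F.L γ (hF ▸ 𝔠).b₀ (hF ▸ 𝔠).p₀ n ^ 2) a 7 C

/-! ## §2 The registered stub (i*)χ from the polymer row, by name -/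

/-- **ONE BLOCK SIZE, ONE MARGIN**: if at `(L, μ)` every constants record with [7]-constants has a rate exponent `0 < a < 1` with `PolymerSlackOnChiKChiV4 L μ 𝔠 a₀ a₁ a`, then the
(i*)χ-clause at `(L, μ)` holds — threshold `γB ⊓ gammaW L 𝔠 0 0 ⊓ e^{2(1−p₀)}`, `π := canonPolymerRows (toCore ∘ p)`, `σ := 7`, and the `ε₀`-uniform constant
`(max(C′,0)/volWeight L M₁)·(C_T + C/(1 − L^{a−1}) + C/(1 − L⁻¹))` (`C′ = max 1 K₀(32,6)`, `C_T = max newConst (oldConst·L⁴·e^{𝔠.κ·L³})`); producer rows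
`pintDecompTrivT_canonRows`, `locCover_canonRows` (at `𝔠.κ`, `kappa_record_admissible`), `locBlockVolumeC_canonRows`, `locMatched_canonRows`, `termSizeTrivT_canonRows` at `κ₁ := 𝔠.κ`
(the two coupling windows from `γ ≤ gammaW`), composed by `globalSupRateWSlackOn_of_polymerWSlackOn_count` and the `Iff.rfl` bridge `printChi_globalSupRateTSlackOn_iff_W`.
[cite: Balaban1985UV3, (7) p.257, (24) p.262, (43)-(47) pp.266-267, (57) p.270; King1986, Thm 3.4 (3.9) p.656, (3.12)-(3.13) p.657] -/
theorem slackOnChiAtChiV4_of_polymerSlackOnChiKChiV4 (L : ℕ) (μ : ℝ)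
    (h : ∀ (𝔠 : AlphaConsts L (suGroupModel 2).N) (a₀ a₁ : ℝ),
      0 < a₀ → 0 < a₁ → 𝔠.B₃ * a₁ ≤ a₀ → ∃ a : ℝ, 0 < a ∧ a < 1 ∧ PolymerSlackOnChiKChiV4 L μ 𝔠 a₀ a₁ a) :
    ∀ (𝔠 : Summit.QuantumFields.Balaban3D.Proofs.Primitives.AlphaConsts L (Summit.QuantumFields.Balaban3D.Carriers.suGroupModel 2).N)
      (a₀ a₁ : ℝ), 0 < a₀ → 0 < a₁ → 𝔠.B₃ * a₁ ≤ a₀ →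
      ∃ a : ℝ, 0 < a ∧ ∃ γB : ℝ, 0 < γB ∧ ∀ (F : T3Family) (γ : ℝ) (hF : F.L = L) (hγ : 0 < γ), γ ≤ γB →
        ∀ (hγ1 : γ ≤ (min (hF ▸ 𝔠).gamma0 1) ^ 2),
          Summit.QuantumFields.YangMills.Theorems.AlphaInputsT3AC.OfV4ChiAt F (hF ▸ 𝔠) a₀ a₁ →
          ∃ (p : ∀ K, Summit.QuantumFields.YangMills.Theorems.AlphaInputsT3AC.PkgAtV4Chi F (hF ▸ 𝔠) γ hγ hγ1 K),
            (∀ K, (p K).a₀ = a₀ ∧ (p K).a₁ = a₁) ∧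
            ∃ (π : Summit.QuantumFields.YangMills.Theorems.AlphaInputsT3AC.PolymerT3 F) (σ : ℕ) (C : ℝ), 7 ≤ σ ∧ 0 ≤ C ∧
              ∀ ε₀ : ℝ, 0 < ε₀ → ε₀ ≤ a₀ →
                Summit.QuantumFields.YangMills.Theorems.PrintChi.GlobalSupRateTSlackOn
                  (fun K n h V => Summit.QuantumFields.YangMills.Theorems.PrintChi.ChiGood F γ (hF ▸ 𝔠).b₀ (hF ▸ 𝔠).p₀ ε₀ μ (n := n) (K := K) h V)
                  (Summit.QuantumFields.YangMills.Theorems.AlphaInputsT3AC.dataOfV4chi p π) (hF ▸ 𝔠).b₀ (hF ▸ 𝔠).p₀ a σ C := by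
  intro 𝔠 a₀ a₁ ha0 ha1 hw
  obtain ⟨a, ha, ha1', C, γB, hC, hγB, hall⟩ := h 𝔠 a₀ a₁ ha0 ha1 hw
  obtain ⟨hκ0, hκ₀⟩ := kappa_record_admissible 𝔠
  refine ⟨a, ha, min γB (min (gammaW L 𝔠 0 0) (Real.exp (2 * (1 - 𝔠.p₀)))),
    lt_min hγB (lt_min (gammaW_pos L 𝔠 0 0) (Real.exp_pos _)), fun F γ hF hγ hγle hγ1 hOf => ?_⟩
  subst hF
  have hγB' : γ ≤ γB := hγle.trans (min_le_left _ _)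
  have hW : γ ≤ gammaW F.L 𝔠 0 0 := hγle.trans ((min_le_right _ _).trans (min_le_left _ _))
  have hγe : Real.sqrt γ ≤ Real.exp (1 - 𝔠.p₀) :=
    sqrt_le_exp_of_le (hγle.trans ((min_le_right _ _).trans (min_le_right _ _)))
  have h1 : γ ≤ gammaθ 𝔠.b₀ (𝔠.p₀ + 𝔠.r₀) (𝔠.ρ / (4 * max 1 𝔠.cB)) := hW.trans ((min_le_right _ _).trans (min_le_left _ _))
  have h2 : γ ≤ gammaθ 𝔠.b₀ 𝔠.p₀ (1 / (2 * (8 * ((F.L : ℝ) + 1) ^ 2 * 𝔠.B₃ * 𝔠.Zfull))) := hW.trans ((min_le_right _ _).trans (min_le_right _ _))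
  have hLn : 1 ≤ F.L := F.hL.2.le
  have hγ1' : γ ≤ 1 := hγ1.trans (sq_min_one_le _ 𝔠.gamma0_pos)
  have hθ0 : ∀ n, 0 ≤ θBal F.L γ 𝔠.b₀ 𝔠.p₀ n := fun n => (T3MinimiserStabilityReduction.θBal_pos hLn hγ hγ1' 𝔠.b₀_pos 𝔠.p₀ n).le
  obtain ⟨p, hp, hrow⟩ := hall F γ rfl hγ hγB' hγ1 hOf
  -- the projected family of data cores and the four producer rows over it
  set q : ∀ K, AlphaInputsT3AC.PkgCoreRows F 𝔠 γ hγ hγ1 K := fun K => (p K).toRows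
  have hw1 := fun K k hk => window_jet (hγ := hγ) (hγ1 := hγ1) h1 K k hk
  have hw2 := fun K k hk => window_oldSlice (hγ := hγ) (hγ1 := hγ1) h2 K k hk
  have hdec := pintDecompTrivT_canonRows q
  have hCnt := locCount_of_cover_of_volumeC (locCover_canonRows q hκ0.le hκ₀) (locBlockVolumeC_canonRows q)
  have hLM := locMatched_canonRows q
  have hTS := termSizeTrivT_canonRows q hκ0 le_rfl hw1 hw2
  have hCT : 0 ≤ max (newConst 𝔠) (oldConst 𝔠 * (F.L : ℝ) ^ 4 * Real.exp (𝔠.κ * (F.L : ℝ) ^ 3)) := le_max_of_le_left (newConst_nonneg 𝔠)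
  refine ⟨p, hp, canonPolymerRows q, 7, _, le_rfl,
    producerConstC_nonneg F (C' := max 1 (K₀ (4 * 2 ^ 3) (2 * 3))) ha1' hC hCT (volWeight_canon_pos 𝔠), fun ε₀ hε hεa => ?_⟩
  exact (printChi_globalSupRateTSlackOn_iff_W _ _ _ _ _ _ _).2
    (globalSupRateWSlackOn_of_polymerWSlackOn_count _ (w := fun n => θBal F.L γ 𝔠.b₀ 𝔠.p₀ n ^ 2) hγ hγ1' 𝔠.b₀_pos
      (fun n => pow_nonneg (hθ0 n) 2) (fun n => pow_le_pow_left₀ (hθ0 (n + 1)) (θBal_succ_le hLn hγ hγ1' hγe 𝔠.b₀_pos.le 𝔠.p₀_pos.le n) 2)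
      ha ha1' hC hCT hdec hCnt hLM hTS (hrow ε₀ hε hεa))

/-- **THE REGISTERED STUB (i*)χ `stub_smallBlocksSlackOnChiAllChiV4` FROM THE PER-POLYMER SLACK ROW ON PRINT'S χ FOR THE CANONICAL TERM FUNCTION, BY NAME.**  If for every odd
`1 < L < 7`, every margin `μ ∈ (0,1)`, every constants record and [7]-constants there is a rate exponent `0 < a < 1` with `PolymerSlackOnChiKChiV4 L μ 𝔠 a₀ a₁ a`, then the text of
`stub_smallBlocksSlackOnChiAllChiV4` (skeleton v5kC of stmt-QuantumFields-20520, OWNER C3 pen `birth_v5kC.lean` 3aa24e4fa8fcb956) holds VERBATIM.  No chart family, no kernel, no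
letter on the record is an input of this implication. [cite: King1986, Thm 3.4 (3.9) p.656, (3.12)-(3.13) p.657; Balaban1985UV3, (43)-(47) pp.266-267, (57) p.270] -/
theorem smallBlocksSlackOnChiAllChiV4_of_polymerSlackOnChiKChiV4
    (h : ∀ (L : ℕ), Odd L → 1 < L → L < 7 → ∀ (μ : ℝ), 0 < μ → μ < 1 → ∀ (𝔠 : AlphaConsts L (suGroupModel 2).N) (a₀ a₁ : ℝ),
      0 < a₀ → 0 < a₁ → 𝔠.B₃ * a₁ ≤ a₀ → ∃ a : ℝ, 0 < a ∧ a < 1 ∧ PolymerSlackOnChiKChiV4 L μ 𝔠 a₀ a₁ a) :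
    ∀ (L : ℕ), Odd L → 1 < L → L < 7 → ∀ (μ : ℝ), 0 < μ → μ < 1 →
      ∀ (𝔠 : Summit.QuantumFields.Balaban3D.Proofs.Primitives.AlphaConsts L (Summit.QuantumFields.Balaban3D.Carriers.suGroupModel 2).N)
        (a₀ a₁ : ℝ), 0 < a₀ → 0 < a₁ → 𝔠.B₃ * a₁ ≤ a₀ →
        ∃ a : ℝ, 0 < a ∧ ∃ γB : ℝ, 0 < γB ∧ ∀ (F : T3Family) (γ : ℝ) (hF : F.L = L) (hγ : 0 < γ), γ ≤ γB →
          ∀ (hγ1 : γ ≤ (min (hF ▸ 𝔠).gamma0 1) ^ 2),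
            Summit.QuantumFields.YangMills.Theorems.AlphaInputsT3AC.OfV4ChiAt F (hF ▸ 𝔠) a₀ a₁ →
            ∃ (p : ∀ K, Summit.QuantumFields.YangMills.Theorems.AlphaInputsT3AC.PkgAtV4Chi F (hF ▸ 𝔠) γ hγ hγ1 K),
              (∀ K, (p K).a₀ = a₀ ∧ (p K).a₁ = a₁) ∧
              ∃ (π : Summit.QuantumFields.YangMills.Theorems.AlphaInputsT3AC.PolymerT3 F) (σ : ℕ) (C : ℝ), 7 ≤ σ ∧ 0 ≤ C ∧
                ∀ ε₀ : ℝ, 0 < ε₀ → ε₀ ≤ a₀ →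
                  Summit.QuantumFields.YangMills.Theorems.PrintChi.GlobalSupRateTSlackOn
                    (fun K n h V => Summit.QuantumFields.YangMills.Theorems.PrintChi.ChiGood F γ (hF ▸ 𝔠).b₀ (hF ▸ 𝔠).p₀ ε₀ μ (n := n) (K := K) h V)
                    (Summit.QuantumFields.YangMills.Theorems.AlphaInputsT3AC.dataOfV4chi p π) (hF ▸ 𝔠).b₀ (hF ▸ 𝔠).p₀ a σ C :=
  fun L hLo hL1 hL7 μ hμ0 hμ1 => slackOnChiAtChiV4_of_polymerSlackOnChiKChiV4 L μ (h L hLo hL1 hL7 μ hμ0 hμ1)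

/-! ## §3 The chart rows are one way to the polymer row -/

/-- **★r1 g4's LETTER-FREE On-χ CHART ROWS GIVE THE POLYMER ROW** (`polymerCauchyMinAtTSlackOn_of_charts` at `κ := 𝔠.κ`, constant `5(C_s²C + 6C_sC_BC_E) + 2C_R`, window
`(C_s + C_B)·θ(n) ≤ 1` from `γ ≤ gammaθ b₀ p₀ (1/max 1 (C_s + C_B))`): nothing proved in the chart currency is lost. [cite: King1986, Prop. 3.6 (3.56) p.662; Balaban1985UV3, (43)-(44) pp.266-267, (47) p.267] -/
theorem polymerSlackOnChiKChiV4_of_k1aChartRowsOnChiKChiV4 {L : ℕ} {μ : ℝ} {𝔠 : AlphaConsts L (suGroupModel 2).N} {a₀ a₁ a : ℝ}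
    (h : K1aChartRowsOnChiKChiV4 L μ 𝔠 a₀ a₁ a) : PolymerSlackOnChiKChiV4 L μ 𝔠 a₀ a₁ a := by
  obtain ⟨C, C_E, C_R, C_s, C_B, γB, hC, hCE, hCR, hCs, hCB, hγB, hall⟩ := h
  have hm0 : 0 < max 1 (C_s + C_B) := lt_of_lt_of_le one_pos (le_max_left _ _)
  refine ⟨5 * (C_s ^ 2 * C + 6 * C_s * C_B * C_E) + 2 * C_R, min γB (gammaθ 𝔠.b₀ 𝔠.p₀ (1 / max 1 (C_s + C_B))), by positivity,
    lt_min hγB (gammaθ_pos 𝔠.b₀_pos 𝔠.p₀_pos (by positivity)), fun F γ hF hγ hγle hγ1 hOf => ?_⟩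
  subst hF
  have hγB' : γ ≤ γB := hγle.trans (min_le_left _ _)
  have h0 : γ ≤ gammaθ 𝔠.b₀ 𝔠.p₀ (1 / max 1 (C_s + C_B)) := hγle.trans (min_le_right _ _)
  have hLn : 1 ≤ F.L := F.hL.2.le
  have hL1 : (1 : ℝ) ≤ (F.L : ℝ) := by exact_mod_cast hLn
  have hγ1' : γ ≤ 1 := hγ1.trans (sq_min_one_le _ 𝔠.gamma0_pos)
  have hθ0 : ∀ n, 0 ≤ θBal F.L γ 𝔠.b₀ 𝔠.p₀ n := fun n => (T3MinimiserStabilityReduction.θBal_pos hLn hγ hγ1' 𝔠.b₀_pos 𝔠.p₀ n).le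
  have hwin : ∀ n, (C_s + C_B) * θBal F.L γ 𝔠.b₀ 𝔠.p₀ n ≤ 1 := fun n => window_sum_le_one hLn 𝔠.b₀_pos 𝔠.p₀_pos hγ hγ1' h0 n
  obtain ⟨p, hp, hrows⟩ := hall F γ rfl hγ hγB' hγ1 hOf
  refine ⟨p, hp, fun ε₀ hε hεa => ?_⟩
  obtain ⟨Φ, e, B, R, hT, hK, hE, hR, hS, hBC⟩ := hrows ε₀ hε hεa
  exact polymerCauchyMinAtTSlackOn_of_charts _ hC hCE hCR hCs hCB hL1 hθ0 hwin hT hK hE hR hS hBC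

end Summit.QuantumFields.YangMills.Theorems.GlobalSlackCanonicalOnChi

end
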